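import Literature.Probability.Percolation.ArmSeparationRotate
import HarnessLib

/-!
# A-priori RSW lower bound for `k ≤ 6` arms of any colours on `𝕋` at `p = 1/2`

Topic: Probability / Percolation; family `crit-perc` (critical site percolation `P_{1/2}` on the
triangular lattice `𝕋 = triGraph`; hexagonal annuli `Λ_N ∖ Λ_n`, `Λ_n = triBall n`,
`|·|_𝕋 = triNorm`, arm events `armEvent κ n N` of `ArmEvents.lean`: `k` pairwise vertex-disjoint
monochromatic self-avoiding paths across the annulus, the `j`-th of colour `κ j`, no cyclic order
imposed). Everything in this file is PROVED; it introduces no definition and no named fact.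

It serves the named fact `Literature.Probability.Percolation.fourArm_exponent`
(`ArmExponents.lean`; Smirnov–Werner, *Critical exponents for two-dimensional percolation*, Math.
Res. Lett. 8 (2001), Thm. 4 of arXiv `math/0109120`, `j = 4`) by supplying, for the four-arm
probability `π₄(n, N) = P_{1/2}(armEvent ![T,F,T,F] n N)` (`critFourArmProb`, `KestenScaling.lean`)
and indeed for every colour sequence of at most six arms, the **a-priori power-law lower bound**
that Smirnov–Werner invoke in §4.2 (p. 9 of the arXiv text, the sentence following (16)): "By
standard RSW theory, `b_j(r, R)` is bounded from below by a power of `R/r`, hence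
`b'_j(R) ≥ const R^{-ζ}` for some `ζ > 0`" — the input of their (17) and of the
quasi-multiplicativity (10) — and that Nolin (*Near-critical percolation in two dimensions*, EJP 13
(2008), Prop. 14 [arXiv 0711.4948: Prop. 13]) records as "`C_j (n/N)^{α_j} ≤ P̂_p(Ã_{j,σ}(n, N))`",
"the lower bound comes from iterating item 3" (RSW extensions). The tree had it for `j = 1` and
for `j = 2`, `σ = BW` (`ArmEventsAPriori.lean`: `exists_rpow_le_polyArmProb_one`,
`exists_rpow_le_critTwoArmProb`); here:

* `exists_pow_le_polyArmProb_sector_dyadic` — for `k ≤ 6`, every `κ : Fin k → Bool`, `n ≥ 3` and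
  every `m`: `P_{1/2}(armEvent κ n (2^{m+2} n)) ≥ c₀^{(2m+1) k}`, `c₀` the RSW box-crossing
  constant of `tri_rsw_half_holds` at aspect ratio `9`;
* `exists_rpow_le_polyArmProb_of_le_six` — hence `c (n/N)^ζ ≤ P_{1/2}(armEvent κ n N)` for all
  `k ≤ 6`, `κ`, `3 ≤ n ≤ N`;
* `exists_rpow_le_polyArmProb_four`, `exists_le_polyArmProb_four_of_le_mul` — the four-arm case,
  and its bounded-ratio form "`π₄(n, N) ≥ c` for `N ≤ 64 n`" used in arm-separation arguments
  (Werner 2009, Lecture 5; Nolin 2008, §4);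
* `polyArmProb_four_le_critTwoArmProb`, `exists_polyArmProb_four_le_rpow` — the elementary upper
  bound `π₄ ≤ b_2 ≤ C (n/N)^α` by dropping two arms (Nolin 2008, §4.1, `A_{j+j',σσ'} ⊆ A_{j,σ}`;
  `armEvent_subset_armEvent_comp`, `exists_critTwoArmProb_le_rpow`).

## The construction

The two-arm bound of `ArmEventsAPriori.lean` glues a dyadic chain of open box crossings in the
closed `60°` sector `{-x₀ ≤ x₁ ≤ 0}` over the right sides of the hexagons and takes its image
under the central symmetry composed with colour exchange for the closed arm. For `k > 2` arms the
`k` chains must live in `k` of the six sectors of `𝕋` (images of that sector under the rotations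
`ρ^i`, `ρ = triRotIso`), some of them adjacent, and the chain of `ArmEventsAPriori.lean` touches
both boundary rays of its sector. We therefore rebuild the chain **strictly inside the open
sector** `{0 < x₀, x₁ < 0, 0 < x₀ + x₁}`: horizontal crossings of
`[2^i n, 2^{i+2} n] × [1 - 2^i n, -1]` (`i ≤ m`) and vertical crossings of
`[2^{i+1} n, 2^{i+2} n] × [1 - 2^{i+1} n, -1]` (`i < m`), boxes of aspect ratio `≤ 9` as soon as
`2^i n ≥ 3` (`exists_pathIn_of_sectorChain`, `exists_sectorPath_of_sectorChain`; gluing by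
`exists_mem_of_cross` exactly as in `exists_pathIn_of_dyadicChain`). The six rotated open sectors
are pairwise disjoint (`rot_sector_injective`: they are told apart by the signs of the three
linear forms `x₀`, `x₁`, `x₀ + x₁`, `rot_sector_signs`), so the `k ≤ 6` rotated and recoloured
chain events `{ω | rotConfig j {v | v ∈ ω ↔ κ j} ∈ chain}` are determined by pairwise disjoint
sets of sites, hence independent (`sitePercolation_real_iInter_eq_prod`), each has the probability
of the chain (rotation invariance `real_preimage_rotConfig`; colour exchange preserves `P_{1/2}`,
`triSitePercolation_half_real_preimage_colour`), which is `≥ c₀^{2m+1}` by RSW and the Harris chain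
(`sitePercolation_real_biInter_ge_prod`, `sitePercolation_harris'`), and arms in distinct sectors
are vertex-disjoint arms (`mem_armEvent_of_sectorPaths`). The threshold `n ≥ 3` is a lattice
effect (Smirnov–Werner, Thm. 4: "for all large enough `r`"; Nolin, §4.1, `n₀(j)`): the open
sectors of `∂Λ_n` are empty for `n = 1`.

## References

* S. Smirnov, W. Werner, *Critical exponents for two-dimensional percolation*, Math. Res. Lett. 8
  (2001) 729–744; arXiv `math/0109120`, §4.2, p. 9 (sentence following (16)), (17), (10).
  [SmirnovWernerMRL2001]
* P. Nolin, *Near-critical percolation in two dimensions*, Electron. J. Probab. 13 (2008), §4.1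
  and Prop. 14 [arXiv 0711.4948: Prop. 13]. [Nolin2008]
* W. Werner, *Lectures on two-dimensional critical percolation*, IAS/Park City Math. Ser. 16
  (2009), Lecture 1 §4 (RSW), Lecture 5 (arm separation). [WernerPCMI2009]
* G. Grimmett, *Percolation*, 2nd ed. (1999), Thm. 2.4 (Harris–FKG), §11.7 (RSW chaining).
  [GrimmettPercolation1999]

Mathlib: `Finset.biUnion`, `Finset.image`, `Real.rpow`, `Real.log`, `Nat.log`,
`SimpleGraph.Walk.toPath`, `interval_cases`; no percolation in Mathlib. Tree: `rotConfig`,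
`mem_rotConfig`, `pathIn_of_rotConfig`, `real_preimage_rotConfig`, `determinedBy_preimage_rotConfig`,
`triNorm_rot`, `rot_apply_formula`, `setOf_mem_iff_true/false` (`ArmSeparationRotate.lean`),
`triAnnSet` (`ArmSeparationReroute.lean`), `triRotIsoPow` (`TriAnnulusCircuit.lean`),
`exists_mem_of_cross`, `dyadicIndex_spec`, `rpow_ratio_le_pow`, `exists_critTwoArmProb_le_rpow`
(`ArmEventsAPriori.lean`), `triHCross`, `triVCross`, `triStripFinset`, `PathIn.exists_support`,
`determinedBy_compl_mem` (`TriRSWChaining.lean`), `tri_rsw_half_holds` (`TriThetaHalf.lean`),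
`sitePercolation_real_biInter_ge_prod`, `DeterminedBy.biInter_finset` (`SiteHarrisChain.lean`),
`sitePercolation_harris'`, `sitePercolation_real_preimage_compl` (`SitePercolationMeasure.lean`,
`TriHexLemma.lean`), `sitePercolation_real_iInter_eq_prod`, `PathIn.exists_walk` (`OneArmLSW.lean`),
`armEvent_subset_armEvent_comp` (`ArmEventsStructure.lean`), `polyArmProb_anti_holds`,
`triNorm_eq_apply_zero` (`ArmEventsProofs.lean`, `ArmEventsAPriori.lean`).
-/

noncomputable section

open MeasureTheory Set

namespace Literature.Probability.Percolation

open LatticeModels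

/-! ### The dyadic chain inside the open sector `{0 < x₀, -x₀ < x₁ < 0}` -/

/-- **Gluing the dyadic chain inside the open sector.** If the parallelograms
`[2^i n, 2^{i+2} n] × [1 - 2^i n, -1]`, `i ≤ k`, are crossed horizontally and the parallelograms
`[2^{i+1} n, 2^{i+2} n] × [1 - 2^{i+1} n, -1]`, `i < k`, vertically by open sites of `ω`
(`2 ≤ n`), then an open `𝕋`-path joins the column `x₀ = n` to the column `x₀ = 2^{k+2} n` inside
`{n ≤ x₀ ≤ 2^{k+2} n, 1 - x₀ ≤ x₁ ≤ -1}` — the chain of `exists_pathIn_of_dyadicChain`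
(Nolin 2008, Prop. 14, lower bound; Smirnov–Werner 2001, §4.2) with every box shrunk by one row at
the top and at the bottom-left corner, so that it avoids the two boundary rays `{x₁ = 0}` and
`{x₁ = -x₀}` of the sector `{-x₀ ≤ x₁ ≤ 0}` (book-keeping clause `x₁ ≥ 1 - 2^k n` on the columns
`x₀ ≥ 2^{k+1} n` for the induction: consecutive horizontal crossings both cross the parallelogram
between them, where they meet its vertical crossing, `exists_mem_of_cross`). [cite: Nolin2008, Prop. 14 (arXiv 0711.4948: Prop. 13)] [cite: SmirnovWernerMRL2001, §4.2 (p. 9, "by standard RSW theory")] -/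
theorem exists_pathIn_of_sectorChain {n : ℕ} (hn : 2 ≤ n) {ω : SiteConfig (Site 2)} :
    ∀ k : ℕ,
      (∀ i : ℕ, i ≤ k → ω ∈ triHCross ((2 ^ i * n : ℕ) : ℤ) (1 - ((2 ^ i * n : ℕ) : ℤ))
          (3 * (2 ^ i * n)) (2 ^ i * n - 2)) →
      (∀ i : ℕ, i < k → ω ∈ triVCross ((2 ^ (i + 1) * n : ℕ) : ℤ) (1 - ((2 ^ (i + 1) * n : ℕ) : ℤ))
          (2 ^ (i + 1) * n) (2 ^ (i + 1) * n - 2)) →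
      ∃ x y : Site 2, x 0 = n ∧ y 0 = ((2 ^ (k + 2) * n : ℕ) : ℤ) ∧
        PathIn triGraph ({z : Site 2 | (n : ℤ) ≤ z 0 ∧ z 0 ≤ ((2 ^ (k + 2) * n : ℕ) : ℤ) ∧
          z 1 ≤ -1 ∧ 1 - z 0 ≤ z 1 ∧
          (((2 ^ (k + 1) * n : ℕ) : ℤ) ≤ z 0 → 1 - ((2 ^ k * n : ℕ) : ℤ) ≤ z 1)} ∩ ω) x y := by
  have hcast : ∀ i : ℕ, ((2 ^ i * n - 2 : ℕ) : ℤ) = ((2 ^ i * n : ℕ) : ℤ) - 2 := fun i => by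
    rw [Nat.cast_sub (le_trans hn (Nat.le_mul_of_pos_left n (Nat.two_pow_pos i)))]
    rfl
  intro k
  induction k with
  | zero =>
    intro hH _
    obtain ⟨x, y, hx0, hy0, hp⟩ := hH 0 le_rfl
    have hc0 := hcast 0
    simp only [pow_zero, one_mul] at hx0 hy0 hp hc0
    refine ⟨x, y, hx0, ?_, hp.mono ?_⟩
    · rw [hy0]; push_cast; ring
    · rintro z ⟨hz, hzω⟩
      rw [mem_triStrip, hc0] at hz
      refine ⟨⟨hz.1, ?_, ?_, ?_, ?_⟩, hzω⟩
      · push_cast at hz ⊢; omega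
      · push_cast at hz ⊢; omega
      · push_cast at hz ⊢; omega
      · intro _; push_cast at hz ⊢; omega
  | succ k ih =>
    intro hH hV
    obtain ⟨x, y, hx0, hy0, hXp⟩ :=
      ih (fun i hi => hH i (Nat.le_succ_of_le hi)) (fun i hi => hV i (Nat.lt_succ_of_lt hi))
    obtain ⟨u, v, hu0, hv0, hYp⟩ := hH (k + 1) le_rfl
    obtain ⟨c, d, hc1, hd1, hZp⟩ := hV k (Nat.lt_succ_self k)
    have hcM := hcast (k + 1)
    -- express all scales through `P = 2^k n` and `M = 2^{k+1} n = 2P`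
    have eB : (2 ^ (k + 2) * n : ℕ) = 2 * (2 ^ (k + 1) * n) := by ring
    have eB' : (2 ^ (k + 1 + 1) * n : ℕ) = 2 * (2 ^ (k + 1) * n) := by ring
    have eC : (2 ^ (k + 1 + 2) * n : ℕ) = 4 * (2 ^ (k + 1) * n) := by ring
    have hMP : (2 ^ (k + 1) * n : ℕ) = 2 * (2 ^ k * n) := by ring
    have hPn : n ≤ 2 ^ k * n := Nat.le_mul_of_pos_left n (Nat.two_pow_pos k)
    rw [eB'] ; rw [eC]
    rw [eB] at hy0 hXp
    generalize eM : (2 ^ (k + 1) * n : ℕ) = M at hMP hu0 hv0 hYp hc1 hd1 hZp hy0 hXp hcM ⊢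
    generalize eP : (2 ^ k * n : ℕ) = P at hMP hPn hXp ⊢
    subst hMP
    -- tight supports
    obtain ⟨SX, hSX, hXp', hXall⟩ := PathIn.exists_support hXp
    obtain ⟨SY, hSY, hYp', hYall⟩ := PathIn.exists_support hYp
    obtain ⟨SZ, hSZ, hZp', hZall⟩ := PathIn.exists_support hZp
    have hPn' : (n : ℤ) ≤ P := by exact_mod_cast hPn
    have hn2 : (2 : ℤ) ≤ n := by exact_mod_cast hn
    have hP0 : (0 : ℤ) ≤ P := by positivity
    have bX : ∀ z ∈ SX, (n : ℤ) ≤ z 0 ∧ z 0 ≤ 2 * (2 * (P : ℤ)) ∧ z 1 ≤ -1 ∧ 1 - z 0 ≤ z 1 ∧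
        (2 * (P : ℤ) ≤ z 0 → 1 - (P : ℤ) ≤ z 1) ∧ z ∈ ω := by
      intro z hz
      obtain ⟨hz1, hz2⟩ := hSX hz
      simp only [Set.mem_setOf_eq] at hz1
      push_cast at hz1
      exact ⟨hz1.1, hz1.2.1, hz1.2.2.1, hz1.2.2.2.1, hz1.2.2.2.2, hz2⟩
    have bY : ∀ z ∈ SY, 2 * (P : ℤ) ≤ z 0 ∧ z 0 ≤ 4 * (2 * (P : ℤ)) ∧ 1 - 2 * (P : ℤ) ≤ z 1 ∧
        z 1 ≤ -1 ∧ z ∈ ω := by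
      intro z hz
      obtain ⟨hz1, hz2⟩ := hSY hz
      rw [mem_triStrip, hcM] at hz1
      push_cast at hz1
      refine ⟨hz1.1, by linarith [hz1.2.1], hz1.2.2.1, by linarith [hz1.2.2.2], hz2⟩
    have bZ : ∀ z ∈ SZ, 2 * (P : ℤ) ≤ z 0 ∧ z 0 ≤ 2 * (2 * (P : ℤ)) ∧ 1 - 2 * (P : ℤ) ≤ z 1 ∧
        z 1 ≤ -1 ∧ z ∈ ω := by
      intro z hz
      obtain ⟨hz1, hz2⟩ := hSZ hz
      rw [mem_triStrip, hcM] at hz1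
      push_cast at hz1
      refine ⟨hz1.1, by linarith [hz1.2.1], hz1.2.2.1, by linarith [hz1.2.2.2], hz2⟩
    rw [hcM] at hd1
    push_cast at hu0 hv0 hc1 hd1 hy0 hx0 ⊢
    have hd1' : d 1 = -1 := by rw [hd1]; ring
    -- the two meeting sites in the parallelogram `[M, 2M] × [1 - M, -1]`
    obtain ⟨z₁, hz₁X, hz₁Z⟩ := exists_mem_of_cross (L := 2 * (P : ℤ)) (R := 2 * (2 * (P : ℤ)))
      (B := 1 - 2 * (P : ℤ)) (T := -1) (by linarith) (by linarith) hXp' (by rw [hx0]; linarith)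
      (by rw [hy0]) (fun z hz h1 _ => ⟨by linarith [(bX z hz).2.2.2.2.1 h1], (bX z hz).2.2.1⟩)
      hZp' (by rw [hc1]) (by rw [hd1'])
      (fun z hz _ _ => ⟨(bZ z hz).1, (bZ z hz).2.1⟩)
    obtain ⟨z₂, hz₂Y, hz₂Z⟩ := exists_mem_of_cross (L := 2 * (P : ℤ)) (R := 2 * (2 * (P : ℤ)))
      (B := 1 - 2 * (P : ℤ)) (T := -1) (by linarith) (by linarith) hYp' (by rw [hu0])
      (by rw [hv0]; linarith) (fun z hz _ _ => ⟨(bY z hz).2.2.1, (bY z hz).2.2.2.1⟩)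
      hZp' (by rw [hc1]) (by rw [hd1'])
      (fun z hz _ _ => ⟨(bZ z hz).1, (bZ z hz).2.1⟩)
    -- the three pieces lie in the target set
    have hmem : ∀ z : Site 2, (n : ℤ) ≤ z 0 → z 0 ≤ 4 * (2 * (P : ℤ)) → z 1 ≤ -1 → 1 - z 0 ≤ z 1 →
        (2 * (2 * (P : ℤ)) ≤ z 0 → 1 - 2 * (P : ℤ) ≤ z 1) → z ∈ ω →
        z ∈ {z : Site 2 | (n : ℤ) ≤ z 0 ∧ z 0 ≤ ((4 * (2 * P) : ℕ) : ℤ) ∧ z 1 ≤ -1 ∧ 1 - z 0 ≤ z 1 ∧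
          (((2 * (2 * P) : ℕ) : ℤ) ≤ z 0 → 1 - ((2 * P : ℕ) : ℤ) ≤ z 1)} ∩ ω := by
      intro z h1 h2 h3 h4 h5 h6
      refine ⟨?_, h6⟩
      simp only [Set.mem_setOf_eq]
      push_cast
      exact ⟨h1, h2, h3, h4, h5⟩
    have hSXbig : SX ⊆ {z : Site 2 | (n : ℤ) ≤ z 0 ∧ z 0 ≤ ((4 * (2 * P) : ℕ) : ℤ) ∧ z 1 ≤ -1 ∧
        1 - z 0 ≤ z 1 ∧ (((2 * (2 * P) : ℕ) : ℤ) ≤ z 0 → 1 - ((2 * P : ℕ) : ℤ) ≤ z 1)} ∩ ω := by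
      intro z hz
      obtain ⟨h1, h2, h3, h4, h5, h6⟩ := bX z hz
      exact hmem z h1 (by linarith) h3 h4 (fun h => by linarith [h5 (by linarith)]) h6
    have hSYbig : SY ⊆ {z : Site 2 | (n : ℤ) ≤ z 0 ∧ z 0 ≤ ((4 * (2 * P) : ℕ) : ℤ) ∧ z 1 ≤ -1 ∧
        1 - z 0 ≤ z 1 ∧ (((2 * (2 * P) : ℕ) : ℤ) ≤ z 0 → 1 - ((2 * P : ℕ) : ℤ) ≤ z 1)} ∩ ω := by
      intro z hz
      obtain ⟨h1, h2, h3, h4, h5⟩ := bY z hz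
      exact hmem z (by linarith) h2 h4 (by linarith) (fun _ => h3) h5
    have hSZbig : SZ ⊆ {z : Site 2 | (n : ℤ) ≤ z 0 ∧ z 0 ≤ ((4 * (2 * P) : ℕ) : ℤ) ∧ z 1 ≤ -1 ∧
        1 - z 0 ≤ z 1 ∧ (((2 * (2 * P) : ℕ) : ℤ) ≤ z 0 → 1 - ((2 * P : ℕ) : ℤ) ≤ z 1)} ∩ ω := by
      intro z hz
      obtain ⟨h1, h2, h3, h4, h5⟩ := bZ z hz
      exact hmem z (by linarith) (by linarith) h4 (by linarith) (fun _ => h3) h5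
    have p1 : PathIn triGraph SX x z₁ := hXall z₁ hz₁X
    have p2 : PathIn triGraph SZ z₁ z₂ := (hZall z₁ hz₁Z).symm.trans (hZall z₂ hz₂Z)
    have p3 : PathIn triGraph SY z₂ v := (hYall z₂ hz₂Y).symm.trans hYp'
    refine ⟨x, v, hx0, ?_, ((p1.mono hSXbig).trans (p2.mono hSZbig)).trans (p3.mono hSYbig)⟩
    rw [hv0]; ring

/-- **The sector chain is an arm inside the open sector.** Under the hypotheses of
`exists_pathIn_of_sectorChain` (`2 ≤ n`) there is an open `𝕋`-path of `ω` from a site of norm `n`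
to a site of norm `2^{k+2} n` all of whose sites lie in the open sector
`{0 < x₀, x₁ < 0, 0 < x₀ + x₁}` (where `|·|_𝕋 = x₀`, `triNorm_eq_apply_zero`) and in the annulus
`{n ≤ |·|_𝕋 ≤ 2^{k+2} n}`. [cite: Nolin2008, Prop. 14 (arXiv 0711.4948: Prop. 13)] -/
theorem exists_sectorPath_of_sectorChain {n : ℕ} (hn : 2 ≤ n) {ω : SiteConfig (Site 2)} (k : ℕ)
    (hH : ∀ i : ℕ, i ≤ k → ω ∈ triHCross ((2 ^ i * n : ℕ) : ℤ) (1 - ((2 ^ i * n : ℕ) : ℤ))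
      (3 * (2 ^ i * n)) (2 ^ i * n - 2))
    (hV : ∀ i : ℕ, i < k → ω ∈ triVCross ((2 ^ (i + 1) * n : ℕ) : ℤ) (1 - ((2 ^ (i + 1) * n : ℕ) : ℤ))
      (2 ^ (i + 1) * n) (2 ^ (i + 1) * n - 2)) :
    ∃ x y : Site 2, triNorm x = n ∧ triNorm y = ((2 ^ (k + 2) * n : ℕ) : ℤ) ∧
      PathIn triGraph ({z : Site 2 | 0 < z 0 ∧ z 1 < 0 ∧ 0 < z 0 + z 1} ∩
        triAnnSet n (2 ^ (k + 2) * n) ∩ ω) x y := by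
  obtain ⟨x, y, hx0, hy0, hp⟩ := exists_pathIn_of_sectorChain hn k hH hV
  have hn2 : (2 : ℤ) ≤ n := by exact_mod_cast hn
  have key : ∀ z ∈ {z : Site 2 | (n : ℤ) ≤ z 0 ∧ z 0 ≤ ((2 ^ (k + 2) * n : ℕ) : ℤ) ∧
          z 1 ≤ -1 ∧ 1 - z 0 ≤ z 1 ∧
          (((2 ^ (k + 1) * n : ℕ) : ℤ) ≤ z 0 → 1 - ((2 ^ k * n : ℕ) : ℤ) ≤ z 1)} ∩ ω,
      triNorm z = z 0 ∧ z ∈ {z : Site 2 | 0 < z 0 ∧ z 1 < 0 ∧ 0 < z 0 + z 1} ∩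
        triAnnSet n (2 ^ (k + 2) * n) ∩ ω := by
    rintro z ⟨hz, hzω⟩
    simp only [Set.mem_setOf_eq] at hz
    have hnorm : triNorm z = z 0 :=
      triNorm_eq_apply_zero (by linarith [hz.2.2.1]) (by linarith [hz.2.2.2.1])
    refine ⟨hnorm, ⟨⟨by linarith [hz.1], by linarith [hz.2.2.1], by linarith [hz.2.2.2.1]⟩, ?_⟩, hzω⟩
    rw [mem_triAnnSet, hnorm]
    exact ⟨hz.1, hz.2.1⟩
  have hxm := key x hp.left_mem
  have hym := key y hp.right_mem
  exact ⟨x, y, by rw [hxm.1, hx0], by rw [hym.1, hy0], hp.mono fun z hz => (key z hz).2⟩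

/-! ### The six rotated sectors are pairwise disjoint -/

/-- **Signs of the three linear forms on the rotated sectors.** For `z` in the open sector
`{0 < x₀, x₁ < 0, 0 < x₀ + x₁}` and `a < 6`, the signs of `w₀`, `w₁`, `w₀ + w₁` at `w = ρ^a z`
(`ρ = triRotIso`, the rotation by `60°`; `rot_apply_formula`) are those of the `a`-th open sector:
`w₀ > 0` iff `a ∈ {0, 1, 5}`, `w₁ > 0` iff `a ∈ {1, 2, 3}`, `w₀ + w₁ > 0` iff `a ∈ {0, 1, 2}`. [folklore] -/
theorem rot_sector_signs {a : ℕ} (ha : a < 6) {z : Site 2} (hz : 0 < z 0 ∧ z 1 < 0 ∧ 0 < z 0 + z 1) :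
    (0 < (triRotIsoPow a z) 0 ↔ (a = 0 ∨ a = 1 ∨ a = 5)) ∧
      (0 < (triRotIsoPow a z) 1 ↔ (a = 1 ∨ a = 2 ∨ a = 3)) ∧
      (0 < (triRotIsoPow a z) 0 + (triRotIsoPow a z) 1 ↔ (a = 0 ∨ a = 1 ∨ a = 2)) := by
  obtain ⟨a00, a01, a10, a11, a20, a21, a30, a31, a40, a41, a50, a51⟩ := rot_apply_formula z
  obtain ⟨hz0, hz1, hz2⟩ := hz
  interval_cases a
  · rw [a00, a01]; omega
  · rw [a10, a11]; omega
  · rw [a20, a21]; omega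
  · rw [a30, a31]; omega
  · rw [a40, a41]; omega
  · rw [a50, a51]; omega

/-- The three sign conditions determine the sector index (a finite check). [folklore] -/
theorem sector_index_unique : ∀ a < 6, ∀ b < 6,
    ((a = 0 ∨ a = 1 ∨ a = 5) ↔ (b = 0 ∨ b = 1 ∨ b = 5)) →
    ((a = 1 ∨ a = 2 ∨ a = 3) ↔ (b = 1 ∨ b = 2 ∨ b = 3)) →
    ((a = 0 ∨ a = 1 ∨ a = 2) ↔ (b = 0 ∨ b = 1 ∨ b = 2)) → a = b := by
  intro a ha b hb h1 h2 h3
  interval_cases a <;> interval_cases b <;> omega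

/-- **The six rotated copies of the open sector are pairwise disjoint**: if `ρ^a z = ρ^b z'` for
sites `z, z'` of the open sector `{0 < x₀, x₁ < 0, 0 < x₀ + x₁}` and `a, b < 6` (`ρ = triRotIso`,
the rotation by `60°`), then `a = b` (the images are the six open sectors cut out by the three
lines `x₀ = 0`, `x₁ = 0`, `x₀ + x₁ = 0`, distinguished by the signs of these three linear
forms). [folklore] -/
theorem rot_sector_injective {a b : ℕ} (ha : a < 6) (hb : b < 6) {z z' : Site 2}
    (hz : 0 < z 0 ∧ z 1 < 0 ∧ 0 < z 0 + z 1) (hz' : 0 < z' 0 ∧ z' 1 < 0 ∧ 0 < z' 0 + z' 1)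
    (h : triRotIsoPow a z = triRotIsoPow b z') : a = b := by
  obtain ⟨s1, s2, s3⟩ := rot_sector_signs ha hz
  obtain ⟨t1, t2, t3⟩ := rot_sector_signs hb hz'
  rw [h] at s1 s2 s3
  exact sector_index_unique a ha b hb (s1.symm.trans t1) (s2.symm.trans t2) (s3.symm.trans t3)

/-! ### Arms in distinct rotated sectors form an arm event -/

/-- **Arms in distinct sectors are vertex-disjoint arms.** If for every `j < k ≤ 6` the
configuration `ω` has a `𝕋`-path of colour `κ j` inside the `j`-th rotated open sector
`ρ^j {0 < x₀, x₁ < 0, 0 < x₀ + x₁}` and the annulus `{n ≤ |·|_𝕋 ≤ N}`, from a site of norm `n`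
to a site of norm `N`, then `ω ∈ armEvent κ n N`: the self-avoiding sub-walks (`Walk.toPath`) are
pairwise vertex-disjoint because the sectors are (`rot_sector_injective`). [cite: Nolin2008, §4.1 and Prop. 14 (arXiv 0711.4948: Prop. 13)] -/
theorem mem_armEvent_of_sectorPaths {k : ℕ} (hk : k ≤ 6) (κ : Fin k → Bool) {n N : ℕ}
    {ω : SiteConfig (Site 2)}
    (h : ∀ j : Fin k, ∃ x y : Site 2, triNorm x = n ∧ triNorm y = N ∧
      PathIn triGraph ((triRotIsoPow (j : ℕ) '' {z : Site 2 | 0 < z 0 ∧ z 1 < 0 ∧ 0 < z 0 + z 1}) ∩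
        triAnnSet n N ∩ {v | v ∈ ω ↔ κ j}) x y) :
    ω ∈ armEvent κ n N := by
  classical
  choose x y hx hy hp using h
  have hW : ∀ j, ∃ W : triGraph.Walk (x j) (y j), ∀ v ∈ W.support,
      v ∈ (triRotIsoPow (j : ℕ) '' {z : Site 2 | 0 < z 0 ∧ z 1 < 0 ∧ 0 < z 0 + z 1}) ∩
        triAnnSet n N ∩ {v | v ∈ ω ↔ κ j} := fun j => (hp j).exists_walk
  choose W hWs using hW
  refine ⟨x, y, fun j => (W j).toPath, fun j => ⟨?_, ?_, (W j).toPath.2, fun v hv => ?_, fun v hv => ?_⟩, ?_⟩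
  · exact mem_triSphere_iff.2 (hx j)
  · exact mem_triSphere_iff.2 (hy j)
  · have hv' := (hWs j v (SimpleGraph.Walk.support_toPath_subset_support (W j) hv)).1.2
    rw [mem_triAnnSet] at hv'
    rcases eq_or_lt_of_le hv'.1 with h1 | h1
    · right; rw [mem_triSphere_iff, ← h1]
    · left
      simp only [Set.mem_sdiff, Finset.mem_coe, mem_triBall_iff, not_le]
      exact ⟨hv'.2, h1⟩
  · exact (hWs j v (SimpleGraph.Walk.support_toPath_subset_support (W j) hv)).2
  · intro i j hij
    rw [Finset.disjoint_left]
    intro v hvi hvj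
    rw [List.mem_toFinset] at hvi hvj
    obtain ⟨⟨⟨z, hz, hzv⟩, -⟩, -⟩ := hWs i v (SimpleGraph.Walk.support_toPath_subset_support (W i) hvi)
    obtain ⟨⟨⟨z', hz', hz'v⟩, -⟩, -⟩ := hWs j v (SimpleGraph.Walk.support_toPath_subset_support (W j) hvj)
    have := rot_sector_injective (lt_of_lt_of_le i.2 hk) (lt_of_lt_of_le j.2 hk) hz hz' (hzv.trans hz'v.symm)
    exact hij (Fin.ext this)

/-! ### Reading a configuration in a colour; rotated and recoloured paths -/

/-- **Colour exchange preserves `P_{1/2}`.** Reading a configuration in colour `b`,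
`ω ↦ {v | v ∈ ω ↔ b}`, is the identity for `b = true` and colour exchange `ω ↦ ωᶜ` for
`b = false` (`setOf_mem_iff_true/false`); both preserve `P_{1/2}` (self-duality of `p = 1/2`,
`sitePercolation_real_preimage_compl`; Smirnov–Werner 2001, Rem. 2). [cite: SmirnovWernerMRL2001, Rem. 2] -/
theorem triSitePercolation_half_real_preimage_colour (b : Bool) (A : Set (SiteConfig (Site 2))) :
    (triSitePercolation half).real
        ((fun ω : SiteConfig (Site 2) => {v : Site 2 | v ∈ ω ↔ b}) ⁻¹' A) =
      (triSitePercolation half).real A := by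
  cases b
  · have h : (fun ω : SiteConfig (Site 2) => {v : Site 2 | v ∈ ω ↔ false}) = compl := by
      funext ω; exact setOf_mem_iff_false ω
    have hs : unitInterval.symm half = half := Subtype.ext (by simp [half]; norm_num)
    rw [h]
    unfold triSitePercolation
    rw [sitePercolation_real_preimage_compl, hs]
  · have h : (fun ω : SiteConfig (Site 2) => {v : Site 2 | v ∈ ω ↔ true}) = id := by
      funext ω; exact setOf_mem_iff_true ω
    rw [h, Set.preimage_id]

/-- **Locality is preserved by reading in a colour**: if `A` is determined by the sites of `F`,
so is `{ω | {v | v ∈ ω ↔ b} ∈ A}` (`determinedBy_compl_mem` for `b = false`). [folklore] -/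
theorem determinedBy_preimage_colour (b : Bool) {A : Set (SiteConfig (Site 2))} {F : Set (Site 2)}
    (hA : DeterminedBy A F) :
    DeterminedBy ((fun ω : SiteConfig (Site 2) => {v : Site 2 | v ∈ ω ↔ b}) ⁻¹' A) F := by
  cases b
  · have h : (fun ω : SiteConfig (Site 2) => {v : Site 2 | v ∈ ω ↔ false}) = compl := by
      funext ω; exact setOf_mem_iff_false ω
    rw [h]
    exact determinedBy_compl_mem hA
  · have h : (fun ω : SiteConfig (Site 2) => {v : Site 2 | v ∈ ω ↔ true}) = id := by
      funext ω; exact setOf_mem_iff_true ω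
    rw [h, Set.preimage_id]
    exact hA

/-- **Back to the original frame, with colours.** If the configuration `ω` read in colour `b`
and in the `i`-th rotated frame, `rotConfig i {v | v ∈ ω ↔ b}`, has an open `𝕋`-path inside
`A`, then `ω` has a `𝕋`-path of colour `b` inside `ρ^i(A)` (`pathIn_of_rotConfig`). [folklore] -/
theorem pathIn_of_rotConfig_colour (i : ℕ) (b : Bool) {A : Set (Site 2)} {ω : SiteConfig (Site 2)}
    {x y : Site 2} (h : PathIn triGraph (A ∩ rotConfig i {v : Site 2 | v ∈ ω ↔ b}) x y) :
    PathIn triGraph ((triRotIsoPow i '' A) ∩ {v | v ∈ ω ↔ b}) (triRotIsoPow i x)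
      (triRotIsoPow i y) := by
  refine pathIn_of_rotConfig i (h.mono ?_)
  rintro v ⟨hvA, hv⟩
  refine ⟨hvA, ?_⟩
  have hv' : triRotIsoPow i v ∈ {v : Site 2 | v ∈ ω ↔ b} := mem_rotConfig.1 hv
  simp only [Set.mem_setOf_eq, mem_rotConfig] at hv' ⊢
  exact hv'

/-! ### The RSW lower bound along dyadic scales for `k ≤ 6` arms of any colours -/

/-- **RSW lower bound along dyadic scales, `k ≤ 6` arms of prescribed colours** (the proof of
the lower half of Nolin 2008, Prop. 14 [arXiv 0711.4948: Prop. 13] — "the lower bound comes from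
iterating item 3" [RSW extensions] — and of Smirnov–Werner 2001, §4.2, "By standard RSW theory,
`b_j(r, R)` is bounded from below by a power of `R/r`", at `p = 1/2`, for up to six arms). There
is `c₀ ∈ (0, 1/2]` (the RSW box-crossing constant of `tri_rsw_half_holds` at aspect ratio `9`)
such that for all `k ≤ 6`, all colour sequences `κ : Fin k → Bool`, all `n ≥ 3` and all `m`,
`P_{1/2}(armEvent κ n (2^{m+2} n)) ≥ c₀^{(2m+1) k}`. Construction: the dyadic chain of `m + 1`
horizontal and `m` vertical open box crossings strictly inside the open sector
`{0 < x₀, x₁ < 0, 0 < x₀ + x₁}` (`exists_sectorPath_of_sectorChain`; boxes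
`[2^i n, 2^{i+2} n] × [1 - 2^i n, -1]` of aspect ratio `≤ 9` for `2^i n ≥ 3`) has probability
`≥ c₀^{2m+1}` (Harris chain `sitePercolation_real_biInter_ge_prod`, Harris's inequality); its
image in the `j`-th rotated frame read in colour `κ j` — the event
`{ω | rotConfig j {v | v ∈ ω ↔ κ j} ∈ chain}` — is an arm of colour `κ j` in the `j`-th rotated
sector (`pathIn_of_rotConfig_colour`), has the same probability (rotation invariance
`real_preimage_rotConfig`, colour exchange `triSitePercolation_half_real_preimage_colour`), and
the `k ≤ 6` events are determined by pairwise disjoint sets of sites (`rot_sector_injective`),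
hence independent (`sitePercolation_real_iInter_eq_prod`); arms in distinct sectors are disjoint
arms (`mem_armEvent_of_sectorPaths`). [cite: Nolin2008, Prop. 14 (arXiv 0711.4948: Prop. 13)] [cite: SmirnovWernerMRL2001, §4.2 (p. 9, "by standard RSW theory")] -/
theorem exists_pow_le_polyArmProb_sector_dyadic :
    ∃ c₀ : ℝ, 0 < c₀ ∧ c₀ ≤ 1 / 2 ∧ ∀ k : ℕ, k ≤ 6 → ∀ (κ : Fin k → Bool) (n m : ℕ), 3 ≤ n →
      c₀ ^ ((2 * m + 1) * k) ≤ polyArmProb κ n (2 ^ (m + 2) * n) := by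
  classical
  obtain ⟨c₀, hc₀, hrsw⟩ := tri_rsw_half_holds (9 : ℝ) (by norm_num)
  have key : ∀ w h : ℕ, 1 ≤ h → w ≤ 9 * h → c₀ ≤ triLRCrossingProb half w h := by
    intro w h hh hw
    have hfl : ⌊(9 : ℝ) * h⌋₊ = 9 * h := by
      have : (9 : ℝ) * h = ((9 * h : ℕ) : ℝ) := by push_cast; ring
      rw [this, Nat.floor_natCast]
    obtain ⟨h1, -⟩ := hrsw h (by rw [hfl]; omega)
    rw [hfl] at h1
    exact h1.trans (triLRCrossingProb_anti_width half hw h)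
  have hc₀le : c₀ ≤ 1 / 2 := by
    have hfl : ⌊(9 : ℝ) * ((1 : ℕ) : ℝ)⌋₊ = 9 := by norm_num
    obtain ⟨h1, h2⟩ := hrsw 1 (by rw [hfl]; norm_num)
    linarith
  refine ⟨c₀, hc₀, hc₀le, fun k hk κ n m hn => ?_⟩
  have hn2 : 2 ≤ n := by omega
  -- the chain events and their supports
  set H : ℕ → Set (SiteConfig (Site 2)) := fun i =>
    triHCross ((2 ^ i * n : ℕ) : ℤ) (1 - ((2 ^ i * n : ℕ) : ℤ)) (3 * (2 ^ i * n)) (2 ^ i * n - 2)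
    with hH
  set FH : ℕ → Finset (Site 2) := fun i =>
    triStripFinset ((2 ^ i * n : ℕ) : ℤ) (1 - ((2 ^ i * n : ℕ) : ℤ)) (3 * (2 ^ i * n)) (2 ^ i * n - 2)
    with hFH
  set V : ℕ → Set (SiteConfig (Site 2)) := fun i =>
    triVCross ((2 ^ (i + 1) * n : ℕ) : ℤ) (1 - ((2 ^ (i + 1) * n : ℕ) : ℤ)) (2 ^ (i + 1) * n)
      (2 ^ (i + 1) * n - 2) with hV
  set FV : ℕ → Finset (Site 2) := fun i =>
    triStripFinset ((2 ^ (i + 1) * n : ℕ) : ℤ) (1 - ((2 ^ (i + 1) * n : ℕ) : ℤ)) (2 ^ (i + 1) * n)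
      (2 ^ (i + 1) * n - 2) with hFV
  set IH : Set (SiteConfig (Site 2)) := ⋂ i ∈ Finset.range (m + 1), H i with hIH
  set IV : Set (SiteConfig (Site 2)) := ⋂ i ∈ Finset.range m, V i with hIV
  set F : Finset (Site 2) := (Finset.range (m + 1)).biUnion FH ∪ (Finset.range m).biUnion FV
    with hF
  -- locality and monotonicity of the chain event `IH ∩ IV`
  have dH : DeterminedBy IH ↑((Finset.range (m + 1)).biUnion FH) :=
    DeterminedBy.biInter_finset _ fun i _ => determinedBy_triHCross _ _ _ _
  have dV : DeterminedBy IV ↑((Finset.range m).biUnion FV) :=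
    DeterminedBy.biInter_finset _ fun i _ => determinedBy_triVCross _ _ _ _
  have dC : DeterminedBy (IH ∩ IV) ↑F := by
    rw [hF, Finset.coe_union]
    exact (dH.mono Set.subset_union_left).inter (dV.mono Set.subset_union_right)
  have uH : IsUpperSet IH := isUpperSet_iInter₂ fun i _ => isUpperSet_triHCross _ _ _ _
  have uV : IsUpperSet IV := isUpperSet_iInter₂ fun i _ => isUpperSet_triVCross _ _ _ _
  have hscale : ∀ i : ℕ, 3 ≤ 2 ^ i * n := fun i =>
    le_trans hn (Nat.le_mul_of_pos_left n (Nat.two_pow_pos i))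
  -- RSW and the Harris chain
  have pH : c₀ ^ (m + 1) ≤ (triSitePercolation half).real IH := by
    have h := sitePercolation_real_biInter_ge_prod half (Finset.range (m + 1)) (E := H) (F := FH)
      (fun i _ => determinedBy_triHCross _ _ _ _) (fun i _ => isUpperSet_triHCross _ _ _ _)
    refine le_trans ?_ h
    calc c₀ ^ (m + 1) = ∏ _i ∈ Finset.range (m + 1), c₀ := by simp
      _ ≤ ∏ i ∈ Finset.range (m + 1), (sitePercolation (Site 2) half).real (H i) := by
          refine Finset.prod_le_prod (fun _ _ => hc₀.le) fun i _ => ?_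
          have : (sitePercolation (Site 2) half).real (H i) =
              triLRCrossingProb half (3 * (2 ^ i * n)) (2 ^ i * n - 2) :=
            triSitePercolation_real_triHCross half _ _ _ _
          rw [this]
          have h3 := hscale i
          exact key _ _ (by omega) (by omega)
  have pV : c₀ ^ m ≤ (triSitePercolation half).real IV := by
    have h := sitePercolation_real_biInter_ge_prod half (Finset.range m) (E := V) (F := FV)
      (fun i _ => determinedBy_triVCross _ _ _ _) (fun i _ => isUpperSet_triVCross _ _ _ _)
    refine le_trans ?_ h
    calc c₀ ^ m = ∏ _i ∈ Finset.range m, c₀ := by simp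
      _ ≤ ∏ i ∈ Finset.range m, (sitePercolation (Site 2) half).real (V i) := by
          refine Finset.prod_le_prod (fun _ _ => hc₀.le) fun i _ => ?_
          have : (sitePercolation (Site 2) half).real (V i) =
              triLRCrossingProb half (2 ^ (i + 1) * n - 2) (2 ^ (i + 1) * n) :=
            triSitePercolation_real_triVCross half _ _ _ _
          rw [this]
          have h3 := hscale (i + 1)
          exact key _ _ (by omega) (by omega)
  have pC : c₀ ^ (2 * m + 1) ≤ (triSitePercolation half).real (IH ∩ IV) := by
    have h := sitePercolation_harris' half dH dV uH uV
    calc c₀ ^ (2 * m + 1) = c₀ ^ (m + 1) * c₀ ^ m := by rw [← pow_add]; ring_nf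
      _ ≤ (triSitePercolation half).real IH * (triSitePercolation half).real IV :=
          mul_le_mul pH pV (by positivity) measureReal_nonneg
      _ ≤ (triSitePercolation half).real (IH ∩ IV) := h
  -- the chain is an open arm inside the open sector
  have hCpath : ∀ ω ∈ IH ∩ IV, ∃ x y : Site 2, triNorm x = n ∧
      triNorm y = ((2 ^ (m + 2) * n : ℕ) : ℤ) ∧
      PathIn triGraph ({z : Site 2 | 0 < z 0 ∧ z 1 < 0 ∧ 0 < z 0 + z 1} ∩
        triAnnSet n (2 ^ (m + 2) * n) ∩ ω) x y := by
    rintro ω ⟨h1, h2⟩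
    rw [hIH] at h1
    rw [hIV] at h2
    simp only [Set.mem_iInter, Finset.mem_range] at h1 h2
    exact exists_sectorPath_of_sectorChain hn2 m (fun i hi => h1 i (Nat.lt_succ_of_le hi))
      (fun i hi => h2 i hi)
  -- the sites of `F` lie in the open sector
  have hcast : ∀ i : ℕ, ((2 ^ i * n - 2 : ℕ) : ℤ) = ((2 ^ i * n : ℕ) : ℤ) - 2 := fun i => by
    rw [Nat.cast_sub (le_trans hn2 (Nat.le_mul_of_pos_left n (Nat.two_pow_pos i)))]
    rfl
  have hFsec : ∀ w ∈ F, 0 < w 0 ∧ w 1 < 0 ∧ 0 < w 0 + w 1 := by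
    intro w hw
    rw [hF, Finset.mem_union, Finset.mem_biUnion, Finset.mem_biUnion] at hw
    rcases hw with ⟨i, -, hw⟩ | ⟨i, -, hw⟩
    · have hw' : w ∈ (↑(FH i) : Set (Site 2)) := hw
      simp only [hFH, coe_triStripFinset, mem_triStrip] at hw'
      rw [hcast i] at hw'
      have h3 : (3 : ℤ) ≤ ((2 ^ i * n : ℕ) : ℤ) := by exact_mod_cast hscale i
      push_cast at hw' h3
      exact ⟨by linarith, by linarith, by linarith⟩
    · have hw' : w ∈ (↑(FV i) : Set (Site 2)) := hw
      simp only [hFV, coe_triStripFinset, mem_triStrip] at hw'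
      rw [hcast (i + 1)] at hw'
      have h3 : (3 : ℤ) ≤ ((2 ^ (i + 1) * n : ℕ) : ℤ) := by exact_mod_cast hscale (i + 1)
      push_cast at hw' h3
      exact ⟨by linarith, by linarith, by linarith⟩
  -- the rotated, recoloured copies of the chain event
  set κ' : ℕ → Bool := fun j => if h : j < k then κ ⟨j, h⟩ else true with hκ'
  set Y : ℕ → Set (SiteConfig (Site 2)) := fun j =>
    (fun ω : SiteConfig (Site 2) => {v : Site 2 | v ∈ ω ↔ κ' j}) ⁻¹' (rotConfig j ⁻¹' (IH ∩ IV))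
    with hY
  set FY : ℕ → Finset (Site 2) := fun j => F.image (triRotIsoPow j) with hFY
  have dY : ∀ j, DeterminedBy (Y j) ↑(FY j) := fun j => by
    show DeterminedBy ((fun ω : SiteConfig (Site 2) => {v : Site 2 | v ∈ ω ↔ κ' j}) ⁻¹'
      (rotConfig j ⁻¹' (IH ∩ IV))) ↑(F.image (triRotIsoPow j))
    rw [Finset.coe_image]
    exact determinedBy_preimage_colour (κ' j) (determinedBy_preimage_rotConfig j dC)
  have pY : ∀ j, (triSitePercolation half).real (Y j) =
      (triSitePercolation half).real (IH ∩ IV) := fun j => by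
    show (triSitePercolation half).real ((fun ω : SiteConfig (Site 2) =>
      {v : Site 2 | v ∈ ω ↔ κ' j}) ⁻¹' (rotConfig j ⁻¹' (IH ∩ IV))) = _
    rw [triSitePercolation_half_real_preimage_colour, real_preimage_rotConfig]
  have hdisj : ∀ i j, i < j → j < k → Disjoint (FY i) (FY j) := by
    intro i j hij hjk
    rw [Finset.disjoint_left]
    intro v hvi hvj
    simp only [hFY, Finset.mem_image] at hvi hvj
    obtain ⟨w, hw, rfl⟩ := hvi
    obtain ⟨w', hw', he⟩ := hvj
    have := rot_sector_injective (by omega) (by omega) (hFsec w hw) (hFsec w' hw') he.symm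
    omega
  -- independence
  have hind : (triSitePercolation half).real (⋂ j < k, Y j) =
      ∏ j ∈ Finset.range k, (triSitePercolation half).real (Y j) :=
    sitePercolation_real_iInter_eq_prod half (fun j _ => dY j) hdisj
  -- the intersection is contained in the arm event
  have hsub : (⋂ j < k, Y j) ⊆ armEvent κ n (2 ^ (m + 2) * n) := by
    intro ω hω
    simp only [Set.mem_iInter] at hω
    refine mem_armEvent_of_sectorPaths hk κ (fun j => ?_)
    have hj : rotConfig j {v : Site 2 | v ∈ ω ↔ κ' j} ∈ IH ∩ IV := hω j j.2
    have hκj : κ' j = κ j := by simp [hκ', j.2]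
    obtain ⟨x, y, hx, hy, hp⟩ := hCpath _ hj
    have hq := pathIn_of_rotConfig_colour (j : ℕ) (κ' j) hp
    rw [hκj] at hq
    refine ⟨triRotIsoPow j x, triRotIsoPow j y, by rw [triNorm_rot, hx], by rw [triNorm_rot, hy],
      hq.mono ?_⟩
    rintro v ⟨⟨u, ⟨hu1, hu2⟩, rfl⟩, hv⟩
    refine ⟨⟨⟨u, hu1, rfl⟩, ?_⟩, hv⟩
    rw [mem_triAnnSet] at hu2 ⊢
    rw [triNorm_rot]
    exact hu2
  -- conclusion
  calc c₀ ^ ((2 * m + 1) * k) = (c₀ ^ (2 * m + 1)) ^ k := pow_mul _ _ _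
    _ ≤ ((triSitePercolation half).real (IH ∩ IV)) ^ k := pow_le_pow_left₀ (by positivity) pC k
    _ = ∏ j ∈ Finset.range k, (triSitePercolation half).real (Y j) := by
        rw [Finset.prod_congr rfl fun j _ => pY j, Finset.prod_const, Finset.card_range]
    _ = (triSitePercolation half).real (⋂ j < k, Y j) := hind.symm
    _ ≤ polyArmProb κ n (2 ^ (m + 2) * n) := measureReal_mono hsub (measure_ne_top _ _)

/-! ### From dyadic scales to power laws -/

/-- **A-priori RSW lower bound for `k ≤ 6` arms of any prescribed colours** (Nolin 2008, Prop. 14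
[arXiv 0711.4948: Prop. 13], lower half, "`C_j (n/N)^{α_j} ≤ P̂_p(Ã_{j,σ}(n, N))`", in the plain
form `A_{j,σ} ⊇ Ã_{j,σ}`, at `p = 1/2`, `j ≤ 6`; Smirnov–Werner 2001, §4.2, p. 9: "By standard RSW
theory, `b_j(r, R)` is bounded from below by a power of `R/r`"). There are `c, ζ > 0` with
`c (n/N)^ζ ≤ P_{1/2}(armEvent κ n N)` for all `k ≤ 6`, all `κ : Fin k → Bool` and all
`3 ≤ n ≤ N` (`exists_pow_le_polyArmProb_sector_dyadic` at `m = ⌊log₂ (N/n)⌋`, anti-monotonicity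
`polyArmProb_anti_holds`, `ζ = 12 log₂ (1/c₀)`, `c = c₀⁶`). The threshold `n ≥ 3` is a lattice
effect (Smirnov–Werner, Thm. 4: "for all large enough `r`"): the chains start strictly inside the
six open sectors of `∂Λ_n`. [cite: Nolin2008, Prop. 14 (arXiv 0711.4948: Prop. 13)] [cite: SmirnovWernerMRL2001, §4.2 (p. 9, "by standard RSW theory")] -/
theorem exists_rpow_le_polyArmProb_of_le_six :
    ∃ c ζ : ℝ, 0 < c ∧ 0 < ζ ∧ ∀ k : ℕ, k ≤ 6 → ∀ (κ : Fin k → Bool) (n N : ℕ), 3 ≤ n → n ≤ N →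
      c * ((n : ℝ) / N) ^ ζ ≤ polyArmProb κ n N := by
  obtain ⟨c₀, hc₀, hc₀le, h⟩ := exists_pow_le_polyArmProb_sector_dyadic
  have hc₀1 : c₀ < 1 := by linarith
  set ζ₁ : ℝ := -Real.log c₀ / Real.log 2 with hζ₁
  have hζ₁pos : 0 < ζ₁ :=
    div_pos (neg_pos.2 (Real.log_neg hc₀ hc₀1)) (Real.log_pos one_lt_two)
  refine ⟨c₀ ^ 6, 12 * ζ₁, by positivity, by positivity, fun k hk κ n N hn hnN => ?_⟩
  have hn1 : 1 ≤ n := by omega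
  obtain ⟨hreal, hN2⟩ := dyadicIndex_spec hn1 hnN
  set m : ℕ := Nat.log 2 (N / n) with hm
  have hmono : polyArmProb κ n (2 ^ (m + 2) * n) ≤ polyArmProb κ n N :=
    polyArmProb_anti_holds _ hnN hN2
  have hpow := rpow_ratio_le_pow hc₀ hc₀1 hn1 hnN hreal
  have hx0 : 0 ≤ (n : ℝ) / N := by positivity
  have hx : 0 ≤ ((n : ℝ) / N) ^ ζ₁ := Real.rpow_nonneg hx0 _
  have hexp : (2 * m + 1) * k ≤ (2 * m + 1) * 6 := Nat.mul_le_mul_left _ hk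
  calc c₀ ^ 6 * ((n : ℝ) / N) ^ (12 * ζ₁) = c₀ ^ 6 * (((n : ℝ) / N) ^ ζ₁) ^ 12 := by
        rw [mul_comm (12 : ℝ) ζ₁, Real.rpow_mul hx0]; norm_cast
    _ ≤ c₀ ^ 6 * (c₀ ^ m) ^ 12 := by gcongr
    _ = c₀ ^ ((2 * m + 1) * 6) := by rw [← pow_mul, ← pow_add]; ring_nf
    _ ≤ c₀ ^ ((2 * m + 1) * k) := pow_le_pow_of_le_one hc₀.le hc₀1.le hexp
    _ ≤ polyArmProb κ n (2 ^ (m + 2) * n) := h k hk κ n m hn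
    _ ≤ polyArmProb κ n N := hmono

/-- **A-priori RSW lower bound for the four-arm probability** (`j = 4`, colours
open/closed/open/closed; Smirnov–Werner 2001, §4.2, p. 9; Nolin 2008, Prop. 14 [arXiv: Prop. 13]):
there are `c, ζ > 0` with `c (n/N)^ζ ≤ π₄(n, N) = P_{1/2}(armEvent ![T,F,T,F] n N)` for all
`3 ≤ n ≤ N` (the tree's `critFourArmProb n N`, `KestenScaling.lean`, unfolds to this
probability). [cite: SmirnovWernerMRL2001, §4.2 (p. 9, "by standard RSW theory")] [cite: Nolin2008, Prop. 14 (arXiv 0711.4948: Prop. 13)] -/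
theorem exists_rpow_le_polyArmProb_four :
    ∃ c ζ : ℝ, 0 < c ∧ 0 < ζ ∧ ∀ n N : ℕ, 3 ≤ n → n ≤ N →
      c * ((n : ℝ) / N) ^ ζ ≤ polyArmProb ![true, false, true, false] n N := by
  obtain ⟨c, ζ, hc, hζ, h⟩ := exists_rpow_le_polyArmProb_of_le_six
  exact ⟨c, ζ, hc, hζ, fun n N hn hnN => h 4 (by norm_num) _ n N hn hnN⟩

/-- **Uniform positivity of the four-arm probability at bounded ratio**: there is `c > 0` with
`c ≤ π₄(n, N)` whenever `3 ≤ n ≤ N ≤ 64 n` (the form used in arm-separation arguments: Werner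
2009, Lecture 5, proof of Lemma 5.2, "`π₄(n, 2n) ≥ c`"; Nolin 2008, §4.1, item 3). [cite: Nolin2008, Prop. 14 (arXiv 0711.4948: Prop. 13)] -/
theorem exists_le_polyArmProb_four_of_le_mul :
    ∃ c : ℝ, 0 < c ∧ ∀ n N : ℕ, 3 ≤ n → n ≤ N → N ≤ 64 * n →
      c ≤ polyArmProb ![true, false, true, false] n N := by
  obtain ⟨c, ζ, hc, hζ, h⟩ := exists_rpow_le_polyArmProb_four
  refine ⟨c * (1 / 64 : ℝ) ^ ζ, by positivity, fun n N hn hnN hN => le_trans ?_ (h n N hn hnN)⟩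
  have hn' : (0 : ℝ) < n := by exact_mod_cast (lt_of_lt_of_le (by norm_num) hn)
  have hN' : (0 : ℝ) < N := by exact_mod_cast (lt_of_lt_of_le (lt_of_lt_of_le (by norm_num) hn) hnN)
  have hratio : (1 / 64 : ℝ) ≤ (n : ℝ) / N := by
    rw [div_le_div_iff₀ (by norm_num) hN']
    have : (N : ℝ) ≤ 64 * n := by exact_mod_cast hN
    linarith
  exact mul_le_mul_of_nonneg_left (Real.rpow_le_rpow (by norm_num) hratio hζ.le) hc.le

/-! ### Upper bounds by dropping arms -/

/-- **Four arms contain two arms**: `π₄(n, N) ≤ b(n, N) = P_{1/2}(armEvent ![T,F] n N)` (the first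
two arms of `![T,F,T,F]`; Nolin 2008, §4.1, `A_{j+j',σσ'} ⊆ A_{j,σ}`). [cite: Nolin2008, §4.1] -/
theorem polyArmProb_four_le_critTwoArmProb (n N : ℕ) :
    polyArmProb ![true, false, true, false] n N ≤ critTwoArmProb n N := by
  unfold critTwoArmProb polyArmProb
  refine measureReal_mono ?_ (measure_ne_top _ _)
  have h := armEvent_subset_armEvent_comp ![true, false, true, false] n N
    (e := Fin.castLE (show 2 ≤ 4 by norm_num)) (Fin.castLE_injective _)
  have e : (![true, false, true, false] ∘ Fin.castLE (show 2 ≤ 4 by norm_num)) = ![true, false] := by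
    funext i; fin_cases i <;> rfl
  rwa [e] at h

/-- **A-priori upper bound for the four-arm probability** (Nolin 2008, Prop. 14 [arXiv: Prop. 13],
upper half, `j = 4`): there are `C, α > 0` with `π₄(n, N) ≤ C (n/N)^α` for all `1 ≤ n ≤ N`
(from the two-arm bound `exists_critTwoArmProb_le_rpow`). [cite: Nolin2008, Prop. 14 (arXiv 0711.4948: Prop. 13)] -/
theorem exists_polyArmProb_four_le_rpow :
    ∃ C α : ℝ, 0 < C ∧ 0 < α ∧ ∀ n N : ℕ, 1 ≤ n → n ≤ N →
      polyArmProb ![true, false, true, false] n N ≤ C * ((n : ℝ) / N) ^ α := by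
  obtain ⟨C, α, hC, hα, h⟩ := exists_critTwoArmProb_le_rpow
  exact ⟨C, α, hC, hα, fun n N hn hnN => (polyArmProb_four_le_critTwoArmProb n N).trans (h n N hn hnN)⟩

end Literature.Probability.Percolation
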